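import Summits.Ventures.PercRepro.Night2LocalD2R14SixZeroD

/-!
# PercRepro — the six-element columns of R1₄ without a far preimage, part E: the incidence bound at one coloop
(night-2, gen 16)

The cell `κ = 1` of proofs/NIGHT-2-k1.md §7.2/§7.4: a six-element shadow set `S` with exactly one coloop `z` of `S`
besides `y`.  The pair sets are 2-subsets of the four-point set `U₀ = S ∖ {y, z}`.

* **`card_pairPre_filter_mem_clF_le_three`**: a point `g ∈ G ∖ S` lies in the closure of at most three pair preimages —
  two pair preimages whose pair sets share a point have `cl B ∩ cl B' ⊆ cl {y, z, a'}` (`a'` the fourth point of `U₀`),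
  so `cl {y, z, g} = cl {y, z, a'}` and every pair preimage with `g` in its closure avoids `a'` in its pair set: at
  most the three 2-subsets of `U₀ ∖ {a'}`;
* **`card_three_mul_le`**: hence `t · (|G ∖ S| − 1) ≤ 3 · |G ∖ S|` for the number `t` of pair preimages with
  `|G ∖ cl B| = 3` (double counting the traces `(G ∖ S) ∩ cl B`, each of size `|G ∖ S| − 1` for those).
-/

namespace PercRepro.Shadow

open Finset PerFlat ThmH

variable {α : Type*} [DecidableEq α] {M : Matroid α} [M.Finite]

open scoped Classical in
/-- Two pair preimages whose pair sets share a point: `B ∩ B'` has three elements containing `y` and the coloop `z`,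
and `cl B ∩ cl B' ⊆ cl (B ∩ B')`. -/
theorem clF_inter_subset_of_meet {G : Finset α} (hG : G ∈ flatsQ M (4 + 1))
    (hsimple : ∀ e ∈ gr M, ∀ f ∈ gr M, e ≠ f → rkN M {e, f} = 2) {y : α} (hyG : y ∈ G)
    (hyc : y ∉ clF M (G.erase y)) {S : Finset α} (hS : S ∈ shadowAt M (4 + 2) 4 (Uq M (4 + 2) 4) G)
    (h6 : S.card = 6) {B B' : Finset α} (hB : B ∈ pairPre M 4 G S) (hB' : B' ∈ pairPre M 4 G S) (hne : B ≠ B')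
    (hmeet : ((S \ B) ∩ (S \ B')).Nonempty) :
    (B ∩ B').card = 3 ∧ y ∈ B ∩ B' ∧ clF M B ∩ clF M B' ⊆ clF M (B ∩ B') := by
  have hGg : G ⊆ gr M := (mem_flatsQ.1 hG).1
  have hSG : S ⊆ G := subset_of_mem_shadowAt hS
  have hBS := subset_of_mem_pairPre hB
  have hB'S := subset_of_mem_pairPre hB'
  have hy : y ∈ B ∩ B' :=
    Finset.mem_inter.2 ⟨mem_of_mem_pairPre hG hyG hyc hB, mem_of_mem_pairPre hG hyG hyc hB'⟩
  -- `|X ∪ X'| = 3`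
  have hXne := sdiff_ne_of_mem_pairPre hB hB' hne
  have hc := card_sdiff_of_mem_pairPre hB
  have hc' := card_sdiff_of_mem_pairPre hB'
  have hu := Finset.card_union_add_card_inter (S \ B) (S \ B')
  have hi : ((S \ B) ∩ (S \ B')).card = 1 := by
    have hpos := Finset.card_pos.2 hmeet
    have hle : ((S \ B) ∩ (S \ B')).card ≤ 1 := by
      by_contra h
      push Not at h
      have h1 : (S \ B) ∩ (S \ B') = S \ B :=
        Finset.eq_of_subset_of_card_le Finset.inter_subset_left (by omega)
      have h2 : (S \ B) ∩ (S \ B') = S \ B' :=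
        Finset.eq_of_subset_of_card_le Finset.inter_subset_right (by omega)
      exact hXne (h1.symm.trans h2)
    omega
  have hc3 : (B ∩ B').card = 3 := by
    have heq : B ∩ B' = S \ ((S \ B) ∪ (S \ B')) := by
      ext t
      rw [Finset.mem_inter, Finset.mem_sdiff, Finset.mem_union, Finset.mem_sdiff, Finset.mem_sdiff]
      constructor
      · rintro ⟨htB, htB'⟩
        exact ⟨hBS htB, by tauto⟩
      · rintro ⟨htS, h⟩
        push Not at h
        exact ⟨h.1 htS, h.2 htS⟩
    rw [heq]
    have h1 := Finset.card_sdiff_add_card_inter S ((S \ B) ∪ (S \ B'))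
    have h2 : S ∩ ((S \ B) ∪ (S \ B')) = (S \ B) ∪ (S \ B') :=
      Finset.inter_eq_right.2 (Finset.union_subset Finset.sdiff_subset Finset.sdiff_subset)
    rw [h2] at h1
    omega
  refine ⟨hc3, hy, ?_⟩
  have hr : 3 ≤ rkN M (B ∩ B') := by
    have hRe : (B ∩ B').erase y ⊆ G.erase y :=
      Finset.erase_subset_erase _ (Finset.inter_subset_left.trans (hBS.trans hSG))
    have hcard : 2 ≤ ((B ∩ B').erase y).card := by rw [Finset.card_erase_of_mem hy, hc3]
    have := three_le_rkN_insert_of_two_le_card hGg hyG hyc hsimple hRe hcard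
    rw [Finset.insert_erase hy] at this
    exact this
  exact clF_inter_subset_clF_of_three_le hG hB hB' hne Finset.inter_subset_left Finset.inter_subset_right hr

open scoped Classical in
/-- **The incidence bound at one coloop**: a point `g ∈ G ∖ S` lies in the closure of at most three pair preimages
(`|S| = 6`, `z` the only coloop of `S` besides `y`, simple matroid). -/
theorem card_pairPre_filter_mem_clF_le_three {G : Finset α} (hG : G ∈ flatsQ M (4 + 1))
    (hsimple : ∀ e ∈ gr M, ∀ f ∈ gr M, e ≠ f → rkN M {e, f} = 2) {y : α} (hyG : y ∈ G)
    (hyc : y ∉ clF M (G.erase y)) {S : Finset α} (hS : S ∈ shadowAt M (4 + 2) 4 (Uq M (4 + 2) 4) G)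
    (h6 : S.card = 6) {z : α} (hzS : z ∈ S) (hzy : z ≠ y) (hz : z ∉ clF M (S.erase z)) {g : α}
    (hg : g ∈ G \ S) : ((pairPre M 4 G S).filter (fun B => g ∈ clF M B)).card ≤ 3 := by
  have hGg : G ⊆ gr M := (mem_flatsQ.1 hG).1
  have hSG : S ⊆ G := subset_of_mem_shadowAt hS
  have hyS : y ∈ S := mem_of_mem_shadowAt_of_coloop (by rw [rkN_erase_eq_of_coloop hG hyG hyc]) hS
  set U₀ := S \ {y, z} with hU₀def
  have hU₀c : U₀.card = 4 := by
    have h := Finset.card_sdiff_add_card_eq_card (show ({y, z} : Finset α) ⊆ S from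
      Finset.insert_subset hyS (Finset.singleton_subset_iff.2 hzS))
    rw [Finset.card_pair hzy.symm, ← hU₀def] at h
    omega
  -- every pair set is a 2-subset of `U₀`
  have hXU : ∀ B ∈ pairPre M 4 G S, S \ B ⊆ U₀ := by
    intro B hB e he
    rw [hU₀def, Finset.mem_sdiff, Finset.mem_insert, Finset.mem_singleton, not_or]
    exact ⟨(Finset.mem_sdiff.1 he).1, fun h => (Finset.mem_sdiff.1 he).2 (h ▸ mem_of_mem_pairPre hG hyG hyc hB),
      fun h => notMem_sdiff_of_mem_pairPre_of_coloop' hG hS hzS hz hB (h ▸ he)⟩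
  by_contra hcon
  push Not at hcon
  -- four distinct pair preimages with `g` in their closures
  obtain ⟨B₁, hB₁⟩ : ((pairPre M 4 G S).filter (fun B => g ∈ clF M B)).Nonempty := Finset.card_pos.1 (by omega)
  have hcard : 2 < (((pairPre M 4 G S).filter (fun B => g ∈ clF M B)).erase B₁).card := by
    rw [Finset.card_erase_of_mem hB₁]
    omega
  rw [Finset.two_lt_card_iff] at hcard
  obtain ⟨B₂, B₃, B₄, hB₂, hB₃, hB₄, h₂₃, h₂₄, h₃₄⟩ := hcard
  rw [Finset.mem_erase] at hB₂ hB₃ hB₄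
  obtain ⟨h₁₂, hB₂⟩ := hB₂
  obtain ⟨h₁₃, hB₃⟩ := hB₃
  obtain ⟨h₁₄, hB₄⟩ := hB₄
  rw [Finset.mem_filter] at hB₁ hB₂ hB₃ hB₄
  -- two of `X₁, X₂, X₃` share a point
  have hmeet : ∃ B B' : Finset α, B ∈ pairPre M 4 G S ∧ B' ∈ pairPre M 4 G S ∧ B ≠ B' ∧ g ∈ clF M B ∧
      g ∈ clF M B' ∧ ((S \ B) ∩ (S \ B')).Nonempty := by
    by_cases h12 : ((S \ B₁) ∩ (S \ B₂)).Nonempty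
    · exact ⟨B₁, B₂, hB₁.1, hB₂.1, h₁₂.symm, hB₁.2, hB₂.2, h12⟩
    · -- `X₂ = U₀ ∖ X₁`, so `X₃` meets `X₁`
      refine ⟨B₁, B₃, hB₁.1, hB₃.1, h₁₃.symm, hB₁.2, hB₃.2, ?_⟩
      by_contra h13
      rw [Finset.not_nonempty_iff_eq_empty] at h12 h13
      -- `X₂ ⊆ U₀ ∖ X₁` and `X₃ ⊆ U₀ ∖ X₁`, both of size 2 = `|U₀ ∖ X₁|`, so `X₂ = X₃`
      have hc₁ := card_sdiff_of_mem_pairPre hB₁.1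
      have hsub : ∀ B ∈ pairPre M 4 G S, (S \ B₁) ∩ (S \ B) = ∅ → S \ B = U₀ \ (S \ B₁) := by
        intro B hB hdis
        apply Finset.eq_of_subset_of_card_le
        · intro e he
          rw [Finset.mem_sdiff]
          refine ⟨hXU B hB he, fun h => ?_⟩
          have : e ∈ (S \ B₁) ∩ (S \ B) := Finset.mem_inter.2 ⟨h, he⟩
          rw [hdis] at this
          exact Finset.notMem_empty _ this
        · rw [Finset.card_sdiff_of_subset (hXU B₁ hB₁.1), hU₀c, hc₁, card_sdiff_of_mem_pairPre hB]
      have e₂ := hsub B₂ hB₂.1 h12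
      have e₃ := hsub B₃ hB₃.1 h13
      exact sdiff_ne_of_mem_pairPre hB₂.1 hB₃.1 h₂₃ (e₂.trans e₃.symm)
  obtain ⟨B, B', hB, hB', hne, hgB, hgB', hmeet⟩ := hmeet
  obtain ⟨hc3, hyI, hI⟩ := clF_inter_subset_of_meet hG hsimple hyG hyc hS h6 hB hB' hne hmeet
  -- the fourth point `a'` of `U₀`: `B ∩ B' = {y, z, a'}`
  have hzI : z ∈ B ∩ B' := by
    rw [Finset.mem_inter]
    constructor
    · by_contra h
      exact notMem_sdiff_of_mem_pairPre_of_coloop' hG hS hzS hz hB (Finset.mem_sdiff.2 ⟨hzS, h⟩)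
    · by_contra h
      exact notMem_sdiff_of_mem_pairPre_of_coloop' hG hS hzS hz hB' (Finset.mem_sdiff.2 ⟨hzS, h⟩)
  obtain ⟨a', ha'⟩ : (((B ∩ B').erase y).erase z).Nonempty := by
    apply Finset.card_pos.1
    rw [Finset.card_erase_of_mem (Finset.mem_erase.2 ⟨hzy, hzI⟩), Finset.card_erase_of_mem hyI, hc3]
    norm_num
  rw [Finset.mem_erase, Finset.mem_erase] at ha'
  obtain ⟨ha'z, ha'y, ha'I⟩ := ha'
  have ha'S : a' ∈ S := subset_of_mem_pairPre hB (Finset.mem_inter.1 ha'I).1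
  have hIeq : B ∩ B' = {y, z, a'} := by
    symm
    apply Finset.eq_of_subset_of_card_le
    · intro e he
      rw [Finset.mem_insert, Finset.mem_insert, Finset.mem_singleton] at he
      rcases he with rfl | rfl | rfl
      · exact hyI
      · exact hzI
      · exact ha'I
    · have h3 : ({y, z, a'} : Finset α).card = 3 :=
        Finset.card_eq_three.2 ⟨y, z, a', hzy.symm, ha'y.symm, ha'z.symm, rfl⟩
      rw [hc3, h3]
  -- `cl {y, z, g} = cl {y, z, a'}`: both rank `3`, `{y, z, g} ⊆ cl {y, z, a'}`
  have hgΛ : g ∈ clF M (B ∩ B') := hI (Finset.mem_inter.2 ⟨hgB, hgB'⟩)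
  have hgS : g ∉ S := (Finset.mem_sdiff.1 hg).2
  have hgy : g ≠ y := fun h => hgS (h ▸ hyS)
  have hgz : g ≠ z := fun h => hgS (h ▸ hzS)
  have hgG : g ∈ G := (Finset.mem_sdiff.1 hg).1
  set R : Finset α := {y, z, g} with hRdef
  have hRr : 3 ≤ rkN M R := by
    have hRe : ({z, g} : Finset α) ⊆ G.erase y := by
      intro e he
      rw [Finset.mem_insert, Finset.mem_singleton] at he
      rcases he with rfl | rfl
      · exact Finset.mem_erase.2 ⟨hzy, hSG hzS⟩
      · exact Finset.mem_erase.2 ⟨hgy, hgG⟩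
    exact three_le_rkN_insert_of_two_le_card hGg hyG hyc hsimple hRe (by rw [Finset.card_pair hgz.symm])
  have hRsub : R ⊆ clF M (B ∩ B') := by
    intro e he
    rw [hRdef, Finset.mem_insert, Finset.mem_insert, Finset.mem_singleton] at he
    have hIg : B ∩ B' ⊆ gr M := Finset.inter_subset_left.trans ((subset_of_mem_pairPre hB).trans (hSG.trans hGg))
    rcases he with rfl | rfl | rfl
    · exact subset_clF_of_subset_gr hIg hyI
    · exact subset_clF_of_subset_gr hIg hzI
    · exact hgΛ
  have hΛsub : clF M (B ∩ B') ⊆ clF M R := by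
    have hΛg : clF M (B ∩ B') ⊆ gr M :=
      (clF_mono Finset.inter_subset_left).trans ((mem_membersIn.1 (mem_pairPre.1 hB).1).2.trans hGg)
    have hr3 : rkN M (clF M (B ∩ B')) ≤ 3 := by
      have h1 : rkN M (clF M (B ∩ B')) ≤ rkN M (B ∩ B') := rkN_le_of_subset_clF' (M := M) (le_refl _)
      have h2 := rkN_le_card_fin (M := M) (B ∩ B')
      omega
    have hge := rkN_mono (M := M) hRsub
    have heq : rkN M R = rkN M (clF M (B ∩ B')) := by omega
    have := subset_closure_of_rkN_eq (M := M) hΛg hRsub heq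
    intro e he
    rw [mem_clF_iff]
    exact this (Finset.mem_coe.2 he)
  have ha'R : a' ∈ clF M R := hΛsub (subset_clF_of_subset_gr
    (Finset.inter_subset_left.trans ((subset_of_mem_pairPre hB).trans (hSG.trans hGg))) ha'I)
  -- every pair preimage with `g` in its closure avoids `a'` in its pair set
  have havoid : ∀ B'' ∈ pairPre M 4 G S, g ∈ clF M B'' → a' ∉ S \ B'' := by
    intro B'' hB'' hgB'' ha'X
    have hRB'' : R ⊆ clF M B'' := by
      intro e he
      rw [hRdef, Finset.mem_insert, Finset.mem_insert, Finset.mem_singleton] at he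
      have hU := (mem_membersIn.1 (mem_pairPre.1 hB'').1).1
      rcases he with rfl | rfl | rfl
      · exact subset_clF hU (mem_of_mem_pairPre hG hyG hyc hB'')
      · exact subset_clF hU (by
          by_contra h
          exact notMem_sdiff_of_mem_pairPre_of_coloop' hG hS hzS hz hB'' (Finset.mem_sdiff.2 ⟨hzS, h⟩))
      · exact hgB''
    have := clF_subset_clF_of_subset_clF hRB'' ha'R
    exact (Finset.mem_sdiff.1 (sdiff_subset_of_mem_pairPre hB'' ha'X)).2 this
  -- so the four pair sets are 2-subsets of the 3-set `U₀ ∖ {a'}`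
  have hmaps : ∀ B'' ∈ (pairPre M 4 G S).filter (fun B => g ∈ clF M B),
      S \ B'' ∈ Finset.powersetCard 2 (U₀.erase a') := by
    intro B'' hB''
    rw [Finset.mem_filter] at hB''
    rw [Finset.mem_powersetCard]
    refine ⟨?_, card_sdiff_of_mem_pairPre hB''.1⟩
    intro e he
    rw [Finset.mem_erase]
    exact ⟨fun h => havoid B'' hB''.1 hB''.2 (h ▸ he), hXU B'' hB''.1 he⟩
  have hinj : Set.InjOn (fun B => S \ B) (((pairPre M 4 G S).filter (fun B => g ∈ clF M B)) : Set (Finset α)) := by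
    intro B hB B' hB' h
    rw [Finset.mem_coe, Finset.mem_filter] at hB hB'
    by_contra hne
    exact sdiff_ne_of_mem_pairPre hB.1 hB'.1 hne h
  have h1 := Finset.card_le_card_of_injOn (fun B => S \ B) hmaps hinj
  have ha'U : a' ∈ U₀ := by
    rw [hU₀def, Finset.mem_sdiff, Finset.mem_insert, Finset.mem_singleton, not_or]
    exact ⟨ha'S, ha'y, ha'z⟩
  rw [Finset.card_powersetCard, Finset.card_erase_of_mem ha'U, hU₀c] at h1
  have h33 : Nat.choose (4 - 1) 2 = 3 := by decide
  omega

open scoped Classical in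
/-- A pair preimage with `|G ∖ cl B| = 3` has a trace `(G ∖ S) ∩ cl B` of `|G ∖ S| − 1` points. -/
theorem card_inter_clF_of_three {G S : Finset α}
    (hS : S ∈ shadowAt M (4 + 2) 4 (Uq M (4 + 2) 4) G) {B : Finset α} (hB : B ∈ pairPre M 4 G S)
    (hc : (G \ clF M B).card = 3) : ((G \ S) ∩ clF M B).card + 1 = (G \ S).card := by
  have hSG : S ⊆ G := subset_of_mem_shadowAt hS
  have hU : B ∈ Uq M (4 + 2) 4 := (mem_membersIn.1 (mem_pairPre.1 hB).1).1
  have hdecomp : G \ clF M B = ((G \ S) \ clF M B) ∪ (S \ B) := by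
    ext e
    rw [Finset.mem_union, Finset.mem_sdiff, Finset.mem_sdiff, Finset.mem_sdiff, Finset.mem_sdiff]
    constructor
    · rintro ⟨heG, hecl⟩
      by_cases heS : e ∈ S
      · exact Or.inr ⟨heS, fun h => hecl (subset_clF hU h)⟩
      · exact Or.inl ⟨⟨heG, heS⟩, hecl⟩
    · rintro (⟨⟨heG, -⟩, hecl⟩ | he)
      · exact ⟨heG, hecl⟩
      · exact ⟨hSG he.1, (Finset.mem_sdiff.1 (sdiff_subset_of_mem_pairPre hB (Finset.mem_sdiff.2 he))).2⟩
  have hdisj : Disjoint ((G \ S) \ clF M B) (S \ B) := by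
    rw [Finset.disjoint_left]
    intro e he he'
    exact (Finset.mem_sdiff.1 (Finset.mem_sdiff.1 he).1).2 (Finset.mem_sdiff.1 he').1
  rw [hdecomp, Finset.card_union_of_disjoint hdisj, card_sdiff_of_mem_pairPre hB] at hc
  have := Finset.card_sdiff_add_card_inter (G \ S) (clF M B)
  omega

open scoped Classical in
/-- **The counting bound at a coloop**: `t · (|G ∖ S| − 1) ≤ 3 · |G ∖ S|` for the number `t` of pair preimages with
`|G ∖ cl B| = 3` (double counting the traces). -/
theorem mul_card_three_le {G : Finset α} (hG : G ∈ flatsQ M (4 + 1))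
    (hsimple : ∀ e ∈ gr M, ∀ f ∈ gr M, e ≠ f → rkN M {e, f} = 2) {y : α} (hyG : y ∈ G)
    (hyc : y ∉ clF M (G.erase y)) {S : Finset α} (hS : S ∈ shadowAt M (4 + 2) 4 (Uq M (4 + 2) 4) G)
    (h6 : S.card = 6) {z : α} (hzS : z ∈ S) (hzy : z ≠ y) (hz : z ∉ clF M (S.erase z)) :
    ((pairPre M 4 G S).filter (fun B => (G \ clF M B).card = 3)).card * ((G \ S).card - 1) ≤
      3 * (G \ S).card := by
  -- double counting `Σ_B |(G ∖ S) ∩ cl B| = Σ_g #{B : g ∈ cl B}`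
  have hdc := Finset.sum_card_bipartiteAbove_eq_sum_card_bipartiteBelow (fun g B => g ∈ clF M B) (s := G \ S)
    (t := pairPre M 4 G S)
  have hL : ∑ g ∈ G \ S, (Finset.bipartiteAbove (fun g B => g ∈ clF M B) (pairPre M 4 G S) g).card ≤
      3 * (G \ S).card := by
    calc ∑ g ∈ G \ S, (Finset.bipartiteAbove (fun g B => g ∈ clF M B) (pairPre M 4 G S) g).card
        ≤ ∑ _g ∈ G \ S, 3 := by
          apply Finset.sum_le_sum
          intro g hg
          exact card_pairPre_filter_mem_clF_le_three hG hsimple hyG hyc hS h6 hzS hzy hz hg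
      _ = 3 * (G \ S).card := by rw [Finset.sum_const, smul_eq_mul, mul_comm]
  have hR : ∑ B ∈ pairPre M 4 G S, (Finset.bipartiteBelow (fun g B => g ∈ clF M B) (G \ S) B).card ≥
      ((pairPre M 4 G S).filter (fun B => (G \ clF M B).card = 3)).card * ((G \ S).card - 1) := by
    have hsub := Finset.sum_le_sum_of_subset_of_nonneg
      (f := fun B => (Finset.bipartiteBelow (fun g B => g ∈ clF M B) (G \ S) B).card)
      (Finset.filter_subset (fun B => (G \ clF M B).card = 3) (pairPre M 4 G S)) (fun _ _ _ => Nat.zero_le _)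
    have hfib : ∀ B ∈ (pairPre M 4 G S).filter (fun B => (G \ clF M B).card = 3),
        (Finset.bipartiteBelow (fun g B => g ∈ clF M B) (G \ S) B).card = (G \ S).card - 1 := by
      intro B hB
      rw [Finset.mem_filter] at hB
      have heq : Finset.bipartiteBelow (fun g B => g ∈ clF M B) (G \ S) B = (G \ S) ∩ clF M B := by
        ext e
        rw [Finset.mem_bipartiteBelow, Finset.mem_inter]
      rw [heq]
      have := card_inter_clF_of_three hS hB.1 hB.2
      omega
    rw [Finset.sum_congr rfl hfib, Finset.sum_const, smul_eq_mul] at hsub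
    exact hsub
  omega

end PercRepro.Shadow
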